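import Summits.BirchSwinnertonDyer.BirchSwinnertonDyer.Theorems.Rank1ResidualJetTransverseClass
import Summits.BirchSwinnertonDyer.BirchSwinnertonDyer.Theorems.ClassRecordThreeCornerAtThreeShimuraWalkFamilyDictionary
import Summits.BirchSwinnertonDyer.BirchSwinnertonDyer.Theorems.ClassRecordThreeEulerHalvesAtThreeKolyvaginFamilyClassCertificate
import Summits.BirchSwinnertonDyer.BirchSwinnertonDyer.Theorems.ErratumRoadFiveShimuraKolyvaginOrderBoundInertCarrierLevelData
import HarnessLib

/-!
# The TRANSVERSE producer `htr` for a family of GENERALISED Kolyvagin data, ROOT form, Gross currency: the class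
# `c_k(Q)` of a `p^u`-th root `Q` of `P_n` lies in `transverseKer ℓ` at every `ℓ ∣ n` (Howard 2004, Lemma 2.7.3)
# (cell `bsd-stepL`, seat `bsd-stepL-corner3-p2` g8 = WIDTH-LEVER lane B; `--supports stmt-BirchSwinnertonDyer-21420 --as helper`)

WHY (CORNER3-G8.md §4 (α); tam3-p1 g13 STATUS 03:34Z). The (P2) walk assembly `Koly.familyLevelSupply_of_memberships`
(tam3-p1) consumes, for every datum `d : JET.KolyvaginFamilyData W K ι n` of the family with `d.y = ys n`, the producer
`htr`: for a `p^u`-th root `Q ∈ E(K[n])` of `P_n = d.derivedPoint` with `u + k ≤ M_Gross(n)`, McCallum's class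
`c_k(Q) ∈ H¹(K, E[p^k])` lies in Jetchev's `transverseKer W K ι p^k ℓ` for every prime `ℓ ∣ n`. Cell bsd-jet proved
this for the `X₀(N)` datum and `u = 0` in W. Zhang's currency (`JET.kolyvaginClass_mem_transverseKer`, Howard's proof of
Lemma 2.7.3 with BRICKS B1–B3). THIS FILE re-proves it for the generalised datum, in ROOT form and in Gross's currency
(`IsKolyvaginPrime` = Gross (3.1)–(3.2), depth `frobLevelIndex`): the proof is Howard's, verbatim, with BRICK B3 taken at
level `k + u` (`red P_n = p^{k+u} b`, `φ² b = b`, so `φ²` fixes `red Q'` for ANY `p^{k+u}`-th root `Q'` of `P_n`, the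
difference being `p^{k+u}`-torsion of `Ẽ`, on which `φ² = Frob_λ` is trivial by (3.2) at depth `k + u`).

RESULTS (namespace `Summit.BirchSwinnertonDyer.BirchSwinnertonDyer.Theorems.ShimuraWalk`):
* `exists_red_derivedPoint_familyData_eq_pow_smul` — BRICK B3 for the generalised datum: `red P_n = p^k • b`, `φ₀² • b = b`.
* `rootClass_familyData_mem_transverseKer` — the producer `htr` (ROOT form, Gross currency, `d_K < -4`).
* `kolyvaginClass_familyData_mem_transverseKer` — the case `u = 0`: `d.kolyvaginClass p k ∈ transverseKer ℓ`.

HONEST FRAMING. Helper lemmas toward crux 21420 `CornerAtThreeW` (line `Lines/inert.lean` r7, stub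
`stub_upper3_residualMulti`) and 19109; nothing about BSD, `J₃`, or any divisibility of a Heegner point is asserted; no
stub is discharged; no item closes; 0 classes move (T7). `K : Type` (the tree's ring-class theory is universe `0`).
The hypothesis `d_K < -4` is bsd-jet's (BRICK B1: `K[c] = K[ℓ] K[c/ℓ]` inside `K̄` uses `𝓞_K^× = {±1}`).
References: [cite: Howard2004HeegnerKolyvagin, Lemma 2.7.3] [cite: Jetchev2008, §3.1.2, Prop. 4.6 (p. 820)] [cite: GrossLMS1991,
§3 (3.2), §4 (4.1), (4.4)] [cite: McCallumLMS1991, §4 (pp. 299–300)]. Axioms: `propext`, `Classical.choice`, `Quot.sound`.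
-/

set_option autoImplicit false
set_option linter.dupNamespace false

noncomputable section

open scoped Classical Pointwise Valued

open WeierstrassCurve Field NumberField IsDedekindDomain Module ValuativeRel
  Literature.NumberTheory.EllipticCurves Literature.NumberTheory.EllipticCurves.RingClassField
  Literature.NumberTheory.EllipticCurves.ModularForms Literature.NumberTheory.EllipticCurves.Jetchev2008
  Literature.NumberTheory.EllipticCurves.KolyvaginCocycle
  Literature.NumberTheory.GaloisRepresentations Literature.NumberTheory.GaloisRepresentations.DiscreteGaloisModule
  Literature.NumberTheory.GaloisRepresentations.IsNonarchimedeanLocalField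
  Literature.NumberTheory.NumberFields Literature.NumberTheory.Automorphic Literature
  Summit.BirchSwinnertonDyer.Rank1Residual Summit.BirchSwinnertonDyer.Rank1Residual.X11b
  Summit.BirchSwinnertonDyer.Rank1Residual.JET Summit.BirchSwinnertonDyer.Rank1Residual.JET.SelmerVocabulary

namespace Summit.BirchSwinnertonDyer.BirchSwinnertonDyer.Theorems.ShimuraWalk

variable {K : Type} [Field K] [NumberField K]

/-! ## §1 BRICK B3 for the generalised datum -/

/-- **The reduction of `P(n)` is `p^k`-divisible by a `φ²`-fixed point** (Howard 2004, proof of Lemma 2.7.3), for the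
GENERALISED datum `d : KolyvaginFamilyData W K ι c`: for `K` imaginary quadratic, `c` square-free with inert prime
factors, a prime `ℓ ∣ c`, `p` odd with `p^k ∣ ℓ + 1`, the place `λ = (ℓ)`, a prime `𝔓 ∣ λ` and ANY additive
`red : E(K̄) → B` into a `Γ_{𝔽̄_ℓ}`-set which is `I_𝔓`-invariant and carries every `g ≡ (z ↦ z^{ℓ²}) (mod 𝔓)` to `φ₀²`:
there is `b` with `red (P(c)) = p^k • b` and `φ₀² • b = b`. bsd-jet's `JET.exists_red_derivedPoint_eq_pow_smul` verbatim
(the datum enters through `y, σ, S, emb` only). [cite: Howard2004HeegnerKolyvagin, Lemma 2.7.3 (proof)] [cite: GrossLMS1991, §3 (3.5), §4 (4.1)] -/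
theorem exists_red_derivedPoint_familyData_eq_pow_smul (hK : IsImaginaryQuadratic K) (ι : K →+* ℂ)
    [∀ j : ℕ, NumberField (ringClassField K ι j)] {c ℓ : ℕ} (hc : Squarefree c) (hℓ : ℓ.Prime)
    (hℓc : ℓ ∣ c) {p k : ℕ} (hp : p.Prime) (hp2 : p ≠ 2) (hpk : p ^ k ∣ ℓ + 1)
    {v : HeightOneSpectrum (𝓞 K)} (hv : v.asIdeal = Ideal.span {((ℓ : ℕ) : 𝓞 K)})
    {𝔓 : Ideal (absIntegers (𝓞 K) K)} (h𝔓 : 𝔓 ∈ v.primesAbove)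
    {W : WeierstrassCurve ℚ} (d : KolyvaginFamilyData W K ι c)
    {B : Type*} [AddCommGroup B] {M : Type*} [Monoid M] [DistribMulAction M B] (φ₀ : M)
    (red : geomPoints (W.baseChange K) →+ B)
    (hredI : ∀ τ ∈ 𝔓.inertia (absoluteGaloisGroup K), ∀ x, red (τ • x) = red x)
    (hredF : ∀ g : absoluteGaloisGroup K, (∀ z : absIntegers (𝓞 K) K, g • z - z ^ (ℓ ^ 2) ∈ 𝔓) →
      ∀ x, red (g • x) = (φ₀ ^ 2) • red x) :
    ∃ b : B, red (d.toGeomPoints d.derivedPoint) = (p ^ k) • b ∧ (φ₀ ^ 2) • b = b := by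
  -- adapted from bsd-jet's `exists_red_derivedPoint_eq_pow_smul` (datum `KolyvaginHeegnerData`)
  have hc0 : c ≠ 0 := hc.ne_zero
  have hℓpf : ℓ ∈ c.primeFactors := Nat.mem_primeFactors.mpr ⟨hℓ, hℓc, hc0⟩
  have hℓL : ℓ ∈ c.primeFactorsList := Nat.mem_primeFactors_iff_mem_primeFactorsList.mp hℓpf
  have hℓcℓ : ¬ ℓ ∣ c / ℓ := fun h ↦ by
    have : ℓ * ℓ ∣ c := by
      have := Nat.mul_dvd_mul_left ℓ h
      rwa [Nat.mul_div_cancel' hℓc] at this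
    exact hℓ.not_isUnit (hc ℓ this)
  set ρ := pointGalHom W (ringClassField K ι c) with hρ
  let e : ringClassField K ι c →ₐ[K] AlgebraicClosure K := { d.emb with commutes' := d.emb_apply }
  have he : ∀ x, e x = d.emb x := fun _ ↦ rfl
  -- the `σ_q`, `q ∣ c`, and the `s ∈ S` lie in the abelian `𝒢_c`
  have hσG : ∀ q ∈ c.primeFactorsList, d.σ q ∈ ringClassGal ι c := fun q hq ↦ by
    have hq' : q ∈ c.primeFactors := Nat.mem_primeFactors_iff_mem_primeFactorsList.mpr hq
    have : d.σ q ∈ Subgroup.zpowers (d.σ q) := Subgroup.mem_zpowers _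
    rw [d.zpowers_σ q hq'] at this
    exact ringClassGalOver_le_ringClassGal ι c _ this
  have hcomm : ∀ q ∈ c.primeFactorsList, ∀ q' ∈ c.primeFactorsList,
      d.σ q * d.σ q' = d.σ q' * d.σ q := fun q hq q' hq' ↦
    commute_of_mem_ringClassGal hK hc0 (hσG q hq) (hσG q' hq')
  have hS : ∀ s ∈ d.S, ∀ q ∈ c.primeFactorsList, s * d.σ q = d.σ q * s := fun s hs q hq ↦
    commute_of_mem_ringClassGal hK hc0 (d.S_subset s hs) (hσG q hq)
  -- `P(c) = D_ℓ X'`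
  have hP : d.derivedPoint = KolyvaginOperator.derivOp ρ (d.σ ℓ) ℓ
      (∑ s ∈ d.S, ρ s (KolyvaginOperator.derivOpProd ρ d.σ (c.primeFactorsList.erase ℓ) d.y)) :=
    derivedPoint_eq_derivOp ρ d.σ d.S d.y hcomm hS hℓL
  set X' := ∑ s ∈ d.S, ρ s (KolyvaginOperator.derivOpProd ρ d.σ (c.primeFactorsList.erase ℓ) d.y)
    with hX'
  -- `σ_ℓ` is induced by an inertia element: `red ∘ toGeomPoints` is `σ_ℓ`-invariant
  have hv' : ∀ w : HeightOneSpectrum (𝓞 K), ((ℓ : ℕ) : 𝓞 K) ∈ w.asIdeal ↔ w = v := fun w ↦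
    ⟨eq_of_natCast_mem_of_asIdeal_eq_span hv w,
      fun h ↦ by rw [h, hv]; exact Ideal.mem_span_singleton_self _⟩
  have hσA : d.σ ℓ ∈ ringClassGalOver ι c (c / ℓ) := by
    rw [← d.zpowers_σ ℓ hℓpf]; exact Subgroup.mem_zpowers _
  obtain ⟨τ₀, hτ₀I, hτ₀⟩ := RingClassTower.exists_mem_inertia_smul_eq_of_mem_ringClassGalOver hK ι
    hc0 hℓ hℓc hℓcℓ hv' h𝔓 e hσA
  set red' : (W.baseChange (ringClassField K ι c)).toAffine.Point →+ B :=
    red.comp d.toGeomPoints with hred'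
  have hinv : ∀ a, red' (ρ (d.σ ℓ) a) = red' a := fun a ↦ by
    change red (d.toGeomPoints (pointGalHom W (ringClassField K ι c) (d.σ ℓ) a)) =
      red (d.toGeomPoints a)
    rw [map_pointGalHom_eq_smul_map W d.emb (fun x ↦ by rw [← he, ← he]; exact hτ₀ x)
      d.toGeomPoints rfl a, hredI τ₀ hτ₀I]
  -- BRICK p512689: `red' (D_ℓ X') = p^k • (q • red' X')`
  obtain ⟨b, hb, a', ha'⟩ := exists_map_derivOp_eq_pow_smul ρ red' hinv hp hp2 hpk X'
  -- the ring class Frobenius fixes `X'`, so `φ₀² • red' X' = red' X'`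
  have hinertℓ : (Ideal.span {((ℓ : ℕ) : 𝓞 K)}).IsPrime := hv ▸ v.isPrime
  obtain ⟨F, hFz, hFfix⟩ := exists_frobSq_forall_smul_emb_eq hK ι hc hℓ hℓc hinertℓ hv h𝔓 e
  have hφX : ∀ Y : (W.baseChange (ringClassField K ι c)).toAffine.Point,
      (φ₀ ^ 2) • red' Y = red' Y := fun Y ↦ by
    change (φ₀ ^ 2) • red (d.toGeomPoints Y) = red (d.toGeomPoints Y)
    rw [← hredF F hFz, d.smul_toGeomPoints_of_forall_emb Y F (fun x ↦ by rw [← he]; exact hFfix x)]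
  refine ⟨b, ?_, ?_⟩
  · rw [hP]
    exact hb
  · rw [ha', hφX]

/-! ## §2 The producer `htr`: ROOT form, Gross currency -/

section Main

variable (W : WeierstrassCurve ℚ) [W.IsElliptic] [W.IsGloballyMinimal]

/-- **The class of a `p^u`-th root of `P_n` is transverse at the primes of `n`** (Howard 2004, Lemma 2.7.3; Jetchev 2008,
p. 820), generalised datum, ROOT form, Gross currency: for `W/ℚ` globally minimal, `K` imaginary quadratic with
`d_K < -4`, `p` odd, `n` square-free all of whose prime factors are Kolyvagin primes in Gross's sense (3.1)–(3.2), a datum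
`d : KolyvaginFamilyData W K ι n`, a point `Q ∈ E(K[n])` with `p^u Q = P_n` whose image is `p^k`-invariant modulo the
admissible `E(K[n])`, and `u + k ≤ M_Gross(n)` (`frobLevelIndex`): McCallum's class `c_k(Q) ∈ H¹(K, E[p^k])` lies in
`transverseKer W K ι p^k ℓ` for every prime `ℓ ∣ n`, i.e. `loc_{w'} res_{K[ℓ]/K} c_k(Q) = 0` at every place `w' ∋ ℓ` of
`K[ℓ]`. This is the producer `htr` of tam3-p1's `Koly.familyLevelSupply_of_memberships`, for every datum of the family.
Proof = bsd-jet's `JET.kolyvaginClass_mem_transverseKer` with BRICK B3 at level `k + u`.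
[cite: Howard2004HeegnerKolyvagin, Lemma 2.7.3] [cite: Jetchev2008, Prop. 4.6 (p. 820)] [cite: GrossLMS1991, §3 (3.2), §4 (4.4)]
[cite: McCallumLMS1991, §4 (pp. 299–300)] -/
theorem rootClass_familyData_mem_transverseKer (hK : IsImaginaryQuadratic K)
    (hD : NumberField.discr K < -4) {p : ℕ} [Fact p.Prime] (hp2 : p ≠ 2) (ι : K →+* ℂ)
    [∀ j : ℕ, NumberField (ringClassField K ι j)] (k : ℕ) {n : ℕ} (hn : Squarefree n)
    (hKol : ∀ q ∈ n.primeFactors, IsKolyvaginPrime (W.conductorNorm ℤ) W K p q)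
    (d : KolyvaginFamilyData W K ι n) (u : ℕ) (Q : (W.baseChange (ringClassField K ι n)).toAffine.Point)
    (hAk : IsAdmissible (absoluteGaloisGroup K) d.pointsSubgroup ((p ^ k : ℕ) : ℤ))
    (hQ : d.toGeomPoints Q ∈ invPoints (absoluteGaloisGroup K) d.pointsSubgroup ((p ^ k : ℕ) : ℤ))
    (hQP : ((p ^ u : ℕ) : ℤ) • Q = d.derivedPoint) (huk : ((u + k : ℕ) : ℕ∞) ≤ frobLevelIndex W K p n)
    {ℓ : ℕ} (hℓ : ℓ ∈ n.primeFactors) :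
    kolyvaginClass (W.baseChange K) ((p ^ k : ℕ) : ℤ)
        ((W.baseChange K).zsmul_geomPoints_surjective_of_charZero
          (by exact_mod_cast pow_ne_zero k (Fact.out : p.Prime).ne_zero)) hAk (d.toGeomPoints Q) hQ ∈
      transverseKer W K ι ((p ^ k : ℕ) : ℤ) ℓ := by
  have hp : p.Prime := Fact.out
  have hn0 : n ≠ 0 := hn.ne_zero
  -- Gross ⟹ Zhang bookkeeping at `ℓ`: `ℓ` is a Zhang–Kolyvagin prime of index `≥ k + u`
  have hfrob : ∀ q ∈ n.primeFactors, FrobEqFrobInfty W K (p ^ (u + k)) q :=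
    (natCast_le_frobLevelIndex_iff hKol (u + k)).mp huk
  have hℓK := hKol ℓ hℓ
  obtain ⟨hℓp, hℓN, -, hℓnep, hinertℓ, hfrob1⟩ := hℓK
  haveI : Fact ℓ.Prime := ⟨hℓp⟩
  have hℓZ : Zhang2014.IsKolyvaginPrime (W.conductorNorm ℤ) W K p ℓ :=
    (Summit.BirchSwinnertonDyer.Rank1Residual.X11b.Three.Koly.zhang_isKolyvaginPrime_of_frobEqFrobInfty (W := W)
      (K := K) hp (le_refl 1) (hKol ℓ hℓ) (by rw [pow_one]; exact hfrob1)).1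
  have hkuM : k + u ≤ Zhang2014.kolyvaginIndex W p ℓ := by
    rw [add_comm]
    exact natCast_le_kolyvaginIndex_of_le_frobDepth hp (hKol ℓ hℓ)
      ((natCast_le_frobDepth_iff hfrob1 (u + k)).mpr (hfrob ℓ hℓ))
  have hkM : k ≤ Zhang2014.kolyvaginIndex W p ℓ := le_trans (Nat.le_add_right k u) hkuM
  have hℓn : ℓ ∣ n := Nat.dvd_of_mem_primeFactors hℓ
  have hpku : p ^ (k + u) ∣ ℓ + 1 := (Zhang2014.le_kolyvaginIndex_iff.mp hkuM).1
  have hinert : ∀ q ∈ n.primeFactors, (Ideal.span {(q : 𝓞 K)}).IsPrime := fun q hq ↦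
    (hKol q hq).2.2.2.2.1
  -- `ℓ ∤ Δ_min`, `ℓ ∤ p^k`, `ℓ ∤ p^(k+u)`
  have hgood : W.HasGoodReductionAtPrime ℓ := by
    by_contra h; exact hℓN ((dvd_conductorNorm_iff_not_hasGoodReductionAtPrime W ℓ).mpr h)
  have hΔ : ¬ (ℓ : ℤ) ∣ minimalDiscriminantInt W :=
    not_dvd_minimalDiscriminantInt_of_hasGoodReductionAtPrime' W ℓ hgood
  have hℓpk : ¬ ℓ ∣ p ^ k := fun h ↦ hℓnep ((Nat.prime_dvd_prime_iff_eq hℓp hp).mp (hℓp.dvd_of_dvd_pow h))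
  have hℓpku : ¬ ℓ ∣ p ^ (k + u) := fun h ↦ hℓnep ((Nat.prime_dvd_prime_iff_eq hℓp hp).mp (hℓp.dvd_of_dvd_pow h))
  have hpk0 : p ^ k ≠ 0 := pow_ne_zero k hp.ne_zero
  have hpku0 : p ^ (k + u) ≠ 0 := pow_ne_zero (k + u) hp.ne_zero
  set N : ℤ := ((p ^ k : ℕ) : ℤ) with hN
  set N' : ℤ := ((p ^ (k + u) : ℕ) : ℤ) with hN'
  set ρK := (W.baseChange K).torsionGaloisModule N with hρK
  set P : geomPoints (W.baseChange K) := d.toGeomPoints Q with hPdef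
  set P₀ : geomPoints (W.baseChange K) := d.toGeomPoints d.derivedPoint with hP₀def
  have hdiv := (W.baseChange K).zsmul_geomPoints_surjective_of_charZero
    (n := N) (by rw [hN]; exact_mod_cast hpk0)
  obtain ⟨Q', hQ'⟩ := hdiv P
  have hQ' : N • Q' = P := hQ'
  have hQ'P₀ : N' • Q' = P₀ := by
    rw [hN', pow_add, Nat.cast_mul, mul_comm, mul_smul, ← hN, hQ', hPdef, ← map_zsmul, hQP]
  rw [kolyvaginClass_eq_cls hAk hQ hQ']
  -- the place `λ = (ℓ)`, the prime `𝔓₀` of the completion, the reduction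
  have hne : Ideal.span {((ℓ : ℕ) : 𝓞 K)} ≠ ⊥ := by rw [Ne, Ideal.span_singleton_eq_bot]; exact_mod_cast hℓp.ne_zero
  let v : HeightOneSpectrum (𝓞 K) := ⟨Ideal.span {((ℓ : ℕ) : 𝓞 K)}, hinertℓ, hne⟩
  have hv : v.asIdeal = Ideal.span {((ℓ : ℕ) : 𝓞 K)} := rfl
  have hℓv : ((ℓ : ℕ) : 𝓞 K) ∈ v.asIdeal := Ideal.mem_span_singleton_self _
  have huniq : ∀ w : HeightOneSpectrum (𝓞 K), (ℓ : 𝓞 K) ∈ w.asIdeal → w = v :=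
    fun w hw ↦ eq_of_natCast_mem_of_asIdeal_eq_span hv w hw
  set 𝔓₀ := adicCompletionPrime K v with h𝔓₀def
  have h𝔓₀ : 𝔓₀ ∈ v.primesAbove := adicCompletionPrime_mem_primesAbove K v
  have hDrange := decompositionSubgroup_adicCompletionPrime_eq_range K v
  have hDfix : 𝔓₀.decompositionSubgroup (absoluteGaloisGroup K) ≤
      torsionFixing (W.baseChange K) N :=
    GlobalDuality.decompositionSubgroup_le_torsionFixing W K hK hℓZ hkM v hℓv h𝔓₀
  have hDfix' : 𝔓₀.decompositionSubgroup (absoluteGaloisGroup K) ≤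
      torsionFixing (W.baseChange K) N' :=
    GlobalDuality.decompositionSubgroup_le_torsionFixing W K hK hℓZ hkuM v hℓv h𝔓₀
  have hresD : ∀ σ : absoluteGaloisGroup (v.adicCompletion K),
      absGaloisRestrict K (v.adicCompletion K) σ ∈ 𝔓₀.decompositionSubgroup (absoluteGaloisGroup K) := fun σ ↦ by
    rw [hDrange]; exact ⟨σ, rfl⟩
  -- the `ℓ`-power Frobenius of `𝔽̄_ℓ` and BRICK B2
  obtain ⟨φ₀, hφ₀'⟩ := WeierstrassCurve.exists_frobenius_absoluteGaloisGroup (ZMod ℓ)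
  have hφ₀ : ∀ x : AlgebraicClosure (ZMod ℓ), φ₀ • x = x ^ ℓ := fun x ↦ by
    rw [hφ₀' x, Nat.card_zmod]
  obtain ⟨red, hsurj, hredI, hredF, hredinj⟩ :=
    exists_kolyvaginReduction W hΔ hφ₀ hℓv huniq h𝔓₀
  -- BRICK B3 at level `k + u`: `red P₀ = p^(k+u) • b`, `φ₀² b = b`
  obtain ⟨b, hb, hφb⟩ := exists_red_derivedPoint_familyData_eq_pow_smul hK ι hn hℓp hℓn hp hp2 hpku
    hv h𝔓₀ d φ₀ red hredI (fun g hg ↦ hredF g 2 hg)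
  -- a Frobenius at `𝔓₀` fixing `K[n]` (hence `E[p^(k+u)]`), so `φ₀²` fixes `Ẽ[p^(k+u)]`
  let e : ringClassField K ι n →ₐ[K] AlgebraicClosure K := { d.emb with commutes' := d.emb_apply }
  have he : ∀ x, e x = d.emb x := fun _ ↦ rfl
  obtain ⟨Fr, hFrz, -⟩ := exists_frobSq_forall_smul_emb_eq hK ι hn hℓp hℓn hinertℓ hv h𝔓₀ e
  have hFrD : Fr ∈ 𝔓₀.decompositionSubgroup (absoluteGaloisGroup K) := by
    haveI := h𝔓₀.1
    have hFr : IsArithFrobAt (𝓞 K) Fr 𝔓₀ := by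
      rw [HeightOneSpectrum.isArithFrobAt_iff_of_mem_primesAbove h𝔓₀,
        residueCard_eq_sq_of_asIdeal_eq_span hK hℓp hinertℓ hv]
      exact hFrz
    exact hFr.mem_stabilizer
  have hφtors : ∀ b' : (reductionModPrime W ℓ).geomPoints, N' • b' = 0 → (φ₀ ^ 2) • b' = b' := by
    intro b' hb'
    obtain ⟨Q'', hQ''0, rfl⟩ := exists_torsion_lift_baseChange W hΔ hredinj hℓpku hpku0 b' hb'
    rw [← hredF Fr 2 hFrz]
    congr 1
    have hQ''mem : Q'' ∈ geomTorsion (W.baseChange K) N' := (mem_geomTorsion_iff _ _ _).mpr hQ''0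
    exact congrArg Subtype.val ((mem_torsionFixing_iff _ _).mp (hDfix' hFrD) ⟨Q'', hQ''mem⟩)
  -- `φ₀²` fixes `red Q'`
  have hφQ : (φ₀ ^ 2) • red Q' = red Q' := by
    have h1 : N' • (red Q' - b) = 0 := by
      rw [smul_sub, ← map_zsmul, hQ'P₀, hP₀def, hb, hN', natCast_zsmul, sub_self]
    have h2 := hφtors _ h1
    rw [smul_sub, hφb] at h2
    exact sub_left_injective h2
  have hφQ' : ∀ j : ℕ, (φ₀ ^ (2 * j)) • red Q' = red Q' := by
    intro j
    induction j with
    | zero => rw [mul_zero, pow_zero, one_smul]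
    | succ j ih => rw [Nat.mul_succ, pow_add, mul_smul, hφQ, ih]
  -- the key vanishing: for `g ∈ D_{𝔓₀}` fixing `P` with `red (g • Q') = red Q'`, `φ g = 0`
  have hcont := continuous_smul_geomPoints (W.baseChange K)
  have hval : ∀ g : absoluteGaloisGroup K, g • P = P → red (g • Q') = red Q' →
      (KolyvaginCocycle.cocycle hAk hcont hQ hQ').1 g = 0 := by
    intro g hgP hgQ
    apply Subtype.ext
    rw [KolyvaginCocycle.coe_cocycle_apply, hgP, sub_self,
      KolyvaginCocycle.rootIn_zero hAk.eq_zero_of_zsmul, sub_zero]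
    change g • Q' - Q' = ((0 : geomTorsion (W.baseChange K) N) : geomPoints (W.baseChange K))
    rw [ZeroMemClass.coe_zero]
    refine hredinj (p ^ k) hℓpk _ ?_ (by rw [map_sub, hgQ, sub_self])
    rw [smul_sub, ← hN, ← KolyvaginCocycle.smul_zsmul_comm, hQ', hgP, sub_self]
  -- transverse kernel: every place `w' ∋ ℓ` of `K[ℓ]`
  refine (mem_transverseKer_iff W K ι N ℓ _).mpr fun w' hw' ↦ ?_
  -- `w'` lies over `λ`
  have hunder : ((ℓ : ℕ) : 𝓞 K) ∈ w'.asIdeal.under (𝓞 K) := by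
    rw [Ideal.under, Ideal.mem_comap, map_natCast]; exact hw'
  have hne' : w'.asIdeal.under (𝓞 K) ≠ ⊥ := by
    intro hbot; rw [hbot, Ideal.mem_bot] at hunder; exact hℓp.ne_zero (by exact_mod_cast hunder)
  have hv₀ : (⟨w'.asIdeal.under (𝓞 K), Ideal.IsPrime.under (𝓞 K) w'.asIdeal, hne'⟩ :
      HeightOneSpectrum (𝓞 K)) = v := huniq _ hunder
  haveI hLO : w'.asIdeal.LiesOver v.asIdeal := ⟨by rw [← hv₀]⟩
  haveI := (finiteDimensional_and_isGalois_ringClassField hK ι hℓp.ne_zero).2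
  letI := (adicCompletionOfLiesOver K (ringClassField K ι ℓ) v w').toAlgebra
  refine (localization_mem_transverseSubgroup_iff ρK (ringClassField K ι ℓ) v w' _).mp ?_
  change galoisCohomology.localization ρK (Sum.inr v) 1
      (oneCocycleClass _ (KolyvaginCocycle.cocycle hAk hcont hQ hQ')) ∈ _
  refine localization_mem_transverseSubgroup_of_forall_apply_eq_zero (W.baseChange K) N
    (ringClassField K ι ℓ) v w' _ ?_
  -- the local cocycle on `Γ_{K[ℓ]_{w'}}`: a homomorphism, unramified, killed by a Frobenius
  let θ' : absoluteGaloisGroup (w'.adicCompletion (ringClassField K ι ℓ)) →ₜ*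
      absoluteGaloisGroup (v.adicCompletion K) :=
    absGaloisRestrict (v.adicCompletion K) (w'.adicCompletion (ringClassField K ι ℓ))
  let ρL : DiscreteGaloisModule (w'.adicCompletion (ringClassField K ι ℓ)) (geomTorsion (W.baseChange K) N) :=
    (GaloisRep.toLocal v ρK).restrictField (w'.adicCompletion (ringClassField K ι ℓ))
  let ψL : contOneCocycles ρL.toTopRep :=
    contOneCocycles.pullback θ' (TopRep.ofHom ⟨ContinuousLinearMap.id ℤ _, fun _ => rfl⟩)
      (contOneCocycles.pullback (absGaloisRestrict K (v.adicCompletion K))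
        (TopRep.ofHom ⟨ContinuousLinearMap.id ℤ _, fun _ => rfl⟩)
        (KolyvaginCocycle.cocycle hAk hcont hQ hQ'))
  have hψL : ∀ g', ψL.1 g' =
      (KolyvaginCocycle.cocycle hAk hcont hQ hQ').1 (absGaloisRestrict K (v.adicCompletion K) (θ' g')) :=
    fun g' ↦ by
    rw [contOneCocycles.pullback_apply, contOneCocycles.pullback_apply]; rfl
  -- elements of `range θ'` fix `K[ℓ]` (FILE A), hence `K[n]` (BRICK B1), hence `P`
  let ιE : ringClassField K ι ℓ →ₐ[K] AlgebraicClosure K := IsAlgClosed.lift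
  have hle : ringClassField K ι ℓ ≤ ringClassField K ι n := ringClassField_mono hK ι hℓn hn0
  obtain ⟨γ, hγ⟩ := RingClassConj.exists_algEquiv_forall_apply_eq hK ι hℓp.ne_zero
    (ιE : ringClassField K ι ℓ →+* AlgebraicClosure K)
    ((e : ringClassField K ι n →+* AlgebraicClosure K).comp
      (RingClassField.inclusion ι hle : ringClassField K ι ℓ →+* ringClassField K ι n))
  have hfixP : ∀ g' : absoluteGaloisGroup (w'.adicCompletion (ringClassField K ι ℓ)),
      absGaloisRestrict K (v.adicCompletion K) (θ' g') • P = P := by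
    intro g'
    have hfixℓ : ∀ y : ringClassField K ι ℓ,
        absGaloisRestrict K (v.adicCompletion K) (θ' g') • ιE y = ιE y :=
      (SemiLocal.mem_range_absGaloisRestrict_adicCompletion_iff v ιE w' (θ' g')).mp ⟨g', rfl⟩
    have hfixc : ∀ x : ringClassField K ι n,
        absGaloisRestrict K (v.adicCompletion K) (θ' g') • e x = e x := by
      refine smul_ringClassField_emb_eq_of_mem_decompositionSubgroup hK hD ι hn hℓp hℓn hinert hv
        h𝔓₀ e (hresD _) fun x hx ↦ ?_
      let x' : ringClassField K ι ℓ := ⟨(x : ℂ), hx⟩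
      have hxx' : x = RingClassField.inclusion ι hle x' :=
        Subtype.ext (by rw [RingClassField.coe_inclusion])
      have hex : e x = ιE (γ x') := by rw [hxx']; exact hγ x'
      rw [hex, hfixℓ]
    exact d.smul_toGeomPoints_of_forall_emb _ _ (fun x ↦ by rw [← he]; exact hfixc x)
  -- pv-1's lemma on the local field `K[ℓ]_{w'}`
  have htriv : ∀ (g' : absoluteGaloisGroup (w'.adicCompletion (ringClassField K ι ℓ)))
      (w : geomTorsion (W.baseChange K) N), ρL g' w = w := by
    intro g' w
    change absGaloisRestrict K (v.adicCompletion K) (θ' g') • w = w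
    exact (mem_torsionFixing_iff _ _).mp (hDfix (hresD _)) w
  obtain ⟨φL, hφL⟩ := exists_isFrobPow_holds (F := (w'.adicCompletion (ringClassField K ι ℓ))) 1
  have hI : ∀ τ ∈ absInertia (w'.adicCompletion (ringClassField K ι ℓ)), ψL.1 τ = 0 := by
    intro τ hτ
    rw [hψL]
    have hτF : θ' τ ∈ absInertia (v.adicCompletion K) :=
      absInertia_map_absGaloisRestrict_le_holds (v.adicCompletion K)
        (w'.adicCompletion (ringClassField K ι ℓ)) ⟨τ, hτ, rfl⟩
    have hτI : absGaloisRestrict K (v.adicCompletion K) (θ' τ) ∈ 𝔓₀.inertia (absoluteGaloisGroup K) := by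
      rw [h𝔓₀def, inertia_adicCompletionPrime_eq_map_absInertia K v]
      exact ⟨θ' τ, hτF, rfl⟩
    exact hval _ (hfixP τ) (hredI _ hτI Q')
  have hφ0 : ψL.1 φL = 0 := by
    rw [hψL]
    -- `θ' φL` is a Frobenius power of exponent `f` for `K_v`, `q_v = ℓ²`
    set f := w'.asIdeal.inertiaDeg (𝓞 K) with hfdef
    have hqv : residueFieldCard (v.adicCompletion K) = ℓ ^ 2 := by
      rw [residueFieldCard_adicCompletion_eq, residueCard_eq_sq_of_asIdeal_eq_span hK hℓp hinertℓ hv]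
    have hqL : residueFieldCard (w'.adicCompletion (ringClassField K ι ℓ)) =
        residueFieldCard (v.adicCompletion K) ^ f := by
      rw [residueFieldCard_adicCompletion_eq, residueFieldCard_adicCompletion_eq]
      exact residueCard_eq_residueCard_pow_inertiaDeg hLO.over.symm
    have hfrobp : IsFrobPow (θ' φL) ((f : ℤ) * 1) :=
      IsFrobPow.absGaloisRestrict_holds (F := (v.adicCompletion K)) hφL f hqL
    rw [mul_one] at hfrobp
    have hfrob' := isFrobPow_natCast_iff.mp hfrobp
    rw [hqv, ← pow_mul] at hfrob'
    have hg : ∀ z : absIntegers (𝓞 K) K,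
        absGaloisRestrict K (v.adicCompletion K) (θ' φL) • z - z ^ (ℓ ^ (2 * f)) ∈ 𝔓₀ := fun z ↦
      forall_smul_sub_pow_mem_adicCompletionPrime v hfrob' z
    refine hval _ (hfixP φL) ?_
    rw [hredF _ (2 * f) hg, hφQ' f]
  intro g'
  have := GlobalDuality.apply_eq_zero_of_unramified_of_apply_frob_eq_zero ρL htriv hφL ψL hI hφ0 g'
  rwa [hψL] at this

/-- **Kolyvagin's class `c_k(n)` of the generalised datum is transverse at the primes of `n`** (the case `u = 0`): under
the hypotheses of `rootClass_familyData_mem_transverseKer` with `k ≤ M_Gross(n)`, `d.kolyvaginClass p k ∈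
transverseKer W K ι p^k ℓ` for every prime `ℓ ∣ n` (junk value `0` off admissibility ∕ invariance). Twin of bsd-jet's
`JET.kolyvaginClass_mem_transverseKer` for `KolyvaginFamilyData`, Gross currency.
[cite: Howard2004HeegnerKolyvagin, Lemma 2.7.3] [cite: Jetchev2008, Prop. 4.6 (p. 820)] [cite: GrossLMS1991, §4 (4.4), (4.6)] -/
theorem kolyvaginClass_familyData_mem_transverseKer (hK : IsImaginaryQuadratic K)
    (hD : NumberField.discr K < -4) {p : ℕ} [Fact p.Prime] (hp2 : p ≠ 2) (ι : K →+* ℂ)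
    [∀ j : ℕ, NumberField (ringClassField K ι j)] (k : ℕ) {n : ℕ} (hn : Squarefree n)
    (hKol : ∀ q ∈ n.primeFactors, IsKolyvaginPrime (W.conductorNorm ℤ) W K p q)
    (hk : (k : ℕ∞) ≤ frobLevelIndex W K p n)
    (d : KolyvaginFamilyData W K ι n) {ℓ : ℕ} (hℓ : ℓ ∈ n.primeFactors) :
    (d.kolyvaginClass (Fact.out : p.Prime) k :
      galoisCohomology ((W.baseChange K).torsionGaloisModule ((p ^ k : ℕ) : ℤ)) 1) ∈
      transverseKer W K ι ((p ^ k : ℕ) : ℤ) ℓ := by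
  by_cases hadm : KolyvaginCocycle.IsAdmissible (absoluteGaloisGroup K) d.pointsSubgroup ((p ^ k : ℕ) : ℤ) ∧
      d.toGeomPoints d.derivedPoint ∈
        KolyvaginCocycle.invPoints (absoluteGaloisGroup K) d.pointsSubgroup ((p ^ k : ℕ) : ℤ)
  swap
  · rw [KolyvaginFamilyData.kolyvaginClass_def, dif_neg hadm]
    exact zero_mem _
  rw [KolyvaginFamilyData.kolyvaginClass_def, dif_pos hadm]
  exact rootClass_familyData_mem_transverseKer W hK hD hp2 ι k hn hKol d 0 d.derivedPoint hadm.1 hadm.2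
    (by rw [pow_zero, Nat.cast_one, one_smul]) (by rw [zero_add]; exact hk) hℓ

end Main

end Summit.BirchSwinnertonDyer.BirchSwinnertonDyer.Theorems.ShimuraWalk

end
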